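import Literature.MathematicalPhysics.QuantumFieldTheory.Balaban1983to89.B7Prop9General
import Literature.MathematicalPhysics.QuantumFieldTheory.Balaban1983to89.B7Prop10Flat

/-!
# `Balaban1983to89.B7Prop10General` — T. Bałaban, *Averaging operations for lattice gauge theories*, Commun. Math. Phys.
**98** (1985) 17–51 [Balaban1985Averaging], Sect. F, **Proposition 10 and the induction (201)–(206) pp. 49–50 AT A GENERAL
(curved) BACKGROUND `U₀`** — kernel form over the concrete model, the printed induction along the levels with the one-step
Proposition 9 at the averaged backgrounds `Ū₀ʲ` (`B7Prop9General.prop9_general`)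

statement-level skeleton of published theorems with citation tags; proofs where landed; nothing here is a claim about the Yang–Mills mass gap

PDF held: `paper:balaban1985-cmp98-averaging` (journal page = PDF page + 16); renders `…/1985-cmp98-averaging-p029`, `p033`,
`p034-x2.png` (pp. 45, 49–50), read as images by the unit; the passage is quoted in full in the module docstring of `B7Prop10Flat`.

CITATION HEADER (lean-in-tree rule).  Cell `lit-balaban` (HOME `run/shared/lean/pub/lit-balaban/`), unit `lit-balaban-r04`
(reader/typer of block B7, gen 2), an ANNOUNCED reader build (HOME/STATUS.md `TAKING B7.Prop10 → B7Prop10General.lean`,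
2026-08-21) — a KERNEL PIECE for SKELETON row `B7.Prop10` (decl of record `B7.Prop10Printed`, abstract; flat kernel
`B7Prop10Flat.prop10_flat`; abstract arithmetic `B7.prop10_induction`); rows touched: B7.Prop10, B7.Eq201 ((201)–(206) @gen),
B7.Eq176 ((178)/(179) at `U₀`: `utilG`).  Nothing of the abstract carrier `B7.lean` is instantiated.

PRINT (p. 49 and p. 50, verbatim excerpts; the full passage in `B7Prop10Flat`).  p. 49: "We will prove by induction that
`|(ũ′ʲ)⁻¹(c₋)R̄ʲ_{0,c}ũ′ʲ(c₊) − 1| < α₄Lʲη + C₄β(Lʲη)², c ⊂ Ω^{(j)}`, (203) `|ũ′ʲ(y) − 1| < α₄ + 2C′₅α₄Lη + … + 2C′₅α₄Lʲη, y ∈ Ω^{(j)}`.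
(204) … We assume them for some `j` and we will prove them for `j + 1`. We apply Proposition 9 with `V₀ = Ū₀ʲ, v′ = ũ′ʲ, v₁ =
\overline{R₀u₁}ʲ`. We have `α₀` replaced by `2α₀(Lʲη)²`, `α′₃` replaced by `α₃Lʲη`, `α₄` replaced by the right-hand side of (204),
which can be bounded by `α₄(1 + 4C′₅) = C₅α₄`, and `α′₄` replaced by the right-hand side of (203), which can be bounded by `2α₄`.
The conditions of the proposition are satisfied if, e.g., `2α₀, α₃, C₅α₄, 2α₄ ≦ c′₆`, so we can apply it and we get … (205) …
(206) Thus we have proved the following"  p. 50: "**Proposition 10.** There exist positive constants `C₄, C₅, c₆` such that for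
arbitrary configurations `U₀, u′, u₁` satisfying (52), (176), (177), (166), (167) with `α₀, α₃, α₄ ≦ c₆` the bounds (203), (204) hold
for `j ≦ k`.  This result implies in particular that the configuration `u′` belongs to the class `Λ_k(C₅α₄)`."

WHAT THIS FILE PROVES (kernel, no `sorry`, standard axioms; all constants explicit).  Setting of `B7Prop9General` (`𝔸` a complete
normed `ℂ`-algebra with `‖1‖ = 1`; backgrounds with values in `U1`; the averaged backgrounds `Ū₀ʲ = B7Prop2Explicit.avgIter L U₀ j`
of (43); the averages `ū₁ʲ = \overline{R₀u₁}ʲ = B7Eq84Concrete.uavg L U₀ u₁ j` of (79)/(80)).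
* §1 `utilG` — **(178)/(179) at `U₀`**: `ũ′⁰ = u′`, `ũ′^{j+1}(z) = ṽ′(Lz)` for the one-step operation `B7Prop9General.vtilG` at the
  background `Ū₀ʲ` with `v′ = ũ′ʲ`, `v₁ = ū₁ʲ`; `utilG_one_left` (= `B7Prop9Flat.util` at `U₀ = 1`).
* §2 the constants `C₆ = C₅ + 1`, `C₇ = C₆ + 2C′₅ + 1`, `C₄ = C4G d L` and the right-hand sides `rhs203G` (= `α₄Lʲη + C₄β(Lʲη)²`,
  `β = α₀α₄ + α₃α₄ + α₄²`), `rhs204G` (= print's (204) plus the level-wise `α₀`-increments of `eq200_general`); `rhs204G_le`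
  (`≤ C₆α₄`), `rhs203G_le` (`≤ 2α₄Lʲη` under `C₄(α₀ + α₃ + α₄) ≤ 1`), **`ineq205G`** = (205) @gen, **`ineq206G`** = (206) @gen.
* §3 **`prop10_general`** — Proposition 10 at `U₀`: under the DISPLAYED level hypotheses `Ū₀ʲ ∈ U1` and `‖Ū₀ʲ(∂p) − 1‖ ≤ 2α₀(Lʲη)²`
  (`j < k`), (176) `SiteBd u′ α₄`, (177) `CovBondBd U₀ u′ (α₄η)`, (166)–(167) `InLambda L U₀ u₁ k α₃ η`, `L ≥ 2`, `Lᵏη ≤ 1` and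
  explicit smallness: for all `j ≤ k`, **(203)** `CovBondBd (Ū₀ʲ) (ũ′ʲ) (α₄Lʲη + C₄β(Lʲη)²)` and **(204)** `SiteBd (ũ′ʲ) (rhs204G j)`;
  `prop10_general'` — the closed forms `2α₄Lʲη`, `C₆α₄` (p. 50: "`u′` belongs to the class `Λ_k(C₅α₄)`", here `C₆`).
* §4 **`levels_of52`**, **`prop10_general_of52`** — the level hypotheses DISCHARGED from (52) by Proposition 2
  (`B7Prop2Explicit.prop2_explicit` with `k := j`, `α₀ := α₀(Lʲη)²`) for `U₀` with values in an average-closed subgroup `G ⊂ U1`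
  (`B7Prop2Explicit.AvgClosed`; the unitary group: `avgClosed_unitaryUnits`), `η = L^{−k}`: Proposition 10 at a general background
  under exactly the printed hypotheses (52), (176), (177), (166), (167), with explicit `c₆ = c₆(d, L)`.
READINGS (recorded; none is an objection to print).  (a) CONSTANTS: print's `C₄ = 8C′₄C₅` (absolute in `L`) and `C₅ = 1 + 4C′₅`
become `C₄ = C4G d L = 2(32(d+1)²C₆L + 9C′₄ + 768(d+1)(d+4)C₇)` and `C₆ = C₅ + 1`: the one-step kernel `B7Prop9General` carries
`α₀`-terms that are `d`-dependent and one power of `L` weaker than print's (199) and present in (200) (its READING (b)); along the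
levels these are absorbed exactly as print absorbs `2α₀C₅α₄` in (205), at the price of the displayed constants — inside print's
"there exist positive constants" at fixed `d`, `L`.  (b) SMALLNESS explicit in place of `c₆` (print: "if, e.g., `2α₀, α₃, C₅α₄, 2α₄ ≦
c′₆`"): `α₃ ≤ 1/50`, `10C₆α₄ ≤ 1`, `3·10³(d+1)Lα₄ ≤ 1`, `C₄(α₀ + α₃ + α₄) ≤ 1`, `1024(d+1)(d+4)L²α₀ ≤ 1`, `32(d+1)²C₆L²α₀ ≤ 1`,
`16dC′₅C₆L²α₀ ≤ 1` (+ Prop. 2's `C₀α₀ ≤ ⅓`, `2α₀ ≤ c′₂` in §4).  (c) `L ≥ 2` as in `B7Prop10Flat` reading (b).  (d) Level hypotheses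
displayed in §3 (so that the theorem applies to any background tower with these bounds) and discharged in §4; the `U1`/Banach
reading of `|·|` as in the lineage.  (e) LATTICE conventions of `B7Eq167Flat`/`B7Prop9Flat` (all of `ℤ^d`, blocks `Lz + [0,L)^d`,
`≤` for `<`).  At `U₀ = 1` (`avgIter_one`, `utilG_one_left`) §3 is `B7Prop10Flat.prop10_flat` up to the constants.
DECLARATIONS: 6 definitions (`utilG C6 C7 C4G rhs203G rhs204G`), the rest theorems (3 private [folklore] helpers); imports
`B7Prop9General`, `B7Prop10Flat`; REUSED BY NAME: `B7Prop9General.prop9_general, vtilG, vtilG_one_left, CovBondBd, CovBlockBd`,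
`B7Prop9Flat.SiteBd, util, util_zero, util_succ, C4', C5'`, `B7Prop10Flat.C5, one_le_C5, C4'_nonneg, C5'_nonneg, siteBd_mono`,
`B7Prop8Flat.pow_eta_le`, `B7Eq167Flat.InLambda, Cond166, Cond167, sum_pow_succ_le`, `B7Eq84Concrete.uavg`, `B7Eq99Concrete.R0fun,
R0fun_add`, `B7Prop2Explicit.avgIter, avgIter_succ, rescale, bavg, pdev, le_pdev, prop2_explicit, AvgClosed, C0, c2'`,
`B7Eq92Concrete.avgIter_one`, `B7.prop2_bound_lt_two_alpha`.  Unit `lit-balaban-r04` (gen 2), 2026-08-21.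

[cite: Balaban1985Averaging, Proposition 10 p.50, (201)–(206) p.49, (176)–(179) p.45, (166)–(167) p.44, (52)–(54) p.26]
-/

noncomputable section

open NormedSpace Finset

namespace Literature.MathematicalPhysics.QuantumFieldTheory.Balaban1983to89.B7Prop10General

open B7Prop1Explicit B7Prop2Explicit MatrixLog B7Eq92Concrete B7Eq99Concrete B7Eq84Concrete B7Eq167Flat B7Prop8Flat
  B7Prop9Flat B7Prop10Flat B7Prop9General

-- `Site` alone would resolve to the torus sites of `Setup.lean`; re-export the `ℤ^d` sites of `B7Prop1Explicit`.
export B7Prop1Explicit (Site)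

variable {d : ℕ}

variable {𝔸 : Type*} [NormedRing 𝔸] [NormOneClass 𝔸] [NormedAlgebra ℂ 𝔸] [CompleteSpace 𝔸]

/-! ## §1 The averages `ũ′ʲ` (178)/(179) at a general background -/

omit [NormOneClass 𝔸] in
/-- **(178)/(179) at a general background `U₀`** (p. 45: "We will consider the averages `ũ′ʲ = \overline{R₀u′u₁}ʲ(\overline{R₀u₁}ʲ)⁻¹`.
(178) … they may be defined inductively as `ũ′¹ = ũ′ = \overline{R₀u′u₁}(\overline{R₀u₁})⁻¹, ũ′^{j+1} =
\overline{R̄₀ʲũ′ʲ\overline{R₀u₁}ʲ}(\overline{R̄₀ʲ\overline{R₀u₁}ʲ})⁻¹`. (179)"): the inductive form (179), the averages at level `j`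
being the twisted block averages (78)/(80) at the averaged background `Ū₀ʲ = B7Prop2Explicit.avgIter L U₀ j`, `\overline{R₀u₁}ʲ =
B7Eq84Concrete.uavg L U₀ u₁ j`, one step = `B7Prop9General.vtilG`; `ũ′⁰ := u′`.  At `U₀ = 1`: `B7Prop9Flat.util` (`utilG_one_left`).
[cite: Balaban1985Averaging, (178)–(179) p.45, (79)–(80) p.30] -/
def utilG (L : ℕ) (U₀ : Site d → Fin d → 𝔸ˣ) (u' u₁ : Site d → 𝔸ˣ) : ℕ → Site d → 𝔸ˣ
  | 0 => u'
  | j + 1 => fun z => vtilG L (avgIter L U₀ j) (utilG L U₀ u' u₁ j) (uavg L U₀ u₁ j) ((L : ℤ) • z)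

omit [NormOneClass 𝔸] in
/-- `utilG_zero`: `ũ′⁰ = u′`. [cite: Balaban1985Averaging, (179) p.45] -/
@[simp] theorem utilG_zero (L : ℕ) (U₀ : Site d → Fin d → 𝔸ˣ) (u' u₁ : Site d → 𝔸ˣ) : utilG L U₀ u' u₁ 0 = u' := rfl

omit [NormOneClass 𝔸] in
/-- `utilG_succ`: (179) unfolded — `ũ′^{j+1}(z) = ṽ′(Lz)` for the one-step operation at the background `Ū₀ʲ` with `v′ = ũ′ʲ`,
`v₁ = ū₁ʲ`. [cite: Balaban1985Averaging, (179) p.45] -/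
theorem utilG_succ (L : ℕ) (U₀ : Site d → Fin d → 𝔸ˣ) (u' u₁ : Site d → 𝔸ˣ) (j : ℕ) :
    utilG L U₀ u' u₁ (j + 1) =
      fun z => vtilG L (avgIter L U₀ j) (utilG L U₀ u' u₁ j) (uavg L U₀ u₁ j) ((L : ℤ) • z) := rfl

omit [NormOneClass 𝔸] in
/-- `utilG_one_left`: at the flat background `ũ′ʲ` is `B7Prop9Flat.util`. [cite: Balaban1985Averaging, (179) p.45] -/
theorem utilG_one_left (L : ℕ) (u' u₁ : Site d → 𝔸ˣ) :
    ∀ j : ℕ, utilG L (1 : Site d → Fin d → 𝔸ˣ) u' u₁ j = util L u' u₁ j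
  | 0 => by rw [utilG_zero, util_zero]
  | j + 1 => by
    funext z
    simp only [utilG_succ, util_succ, avgIter_one, utilG_one_left L u' u₁ j, vtilG_one_left]

omit [NormOneClass 𝔸] [NormedAlgebra ℂ 𝔸] [CompleteSpace 𝔸] in
/-- Monotonicity of (180b)/(203) at a general background in the constant. [cite: Balaban1985Averaging, (180) p.46] -/
theorem covBondBd_mono {V₀ : Site d → Fin d → 𝔸ˣ} {v : Site d → 𝔸ˣ} {α α' : ℝ} (h : CovBondBd V₀ v α) (hle : α ≤ α') :
    CovBondBd V₀ v α' :=
  fun x κ => (h x κ).trans hle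

/-! ## §2 The constants and the right-hand sides of (203)/(204) at a general background -/

/-- `C₆ := C₅ + 1 = 2 + 4C′₅` — the bound `(204)ⱼ ≤ C₆α₄` replacing print's `C₅α₄` (p. 49: "which can be bounded by `α₄(1 + 4C′₅) =
C₅α₄`"), the extra `α₄` absorbing the `α₀`-terms of `B7Prop9General.eq200_general` summed over the levels.
[cite: Balaban1985Averaging, (204) p.49] -/
def C6 (d : ℕ) : ℝ := C5 d + 1

/-- `C₇ := C₆ + 2C′₅ + 1` — bounds the bracket `α₄ + C′₅L(α′₄ + 4dLα₀α₄)` of `B7Prop9General.eq199_general` by `C₇α₄` along the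
levels. [cite: Balaban1985Averaging, (205) p.49] -/
def C7 (d : ℕ) : ℝ := C6 d + 2 * C5' d + 1

/-- **The constant `C₄` of (203) at a general background**, `C₄ = C₄(d, L)`: twice the sum of the three `β(L^{j+1}η)²`-coefficients
produced by one step of `B7Prop9General.eq199_general` (print: `C₄ = 8C′₄C₅`, absolute in `L`; here the `α₀`-terms of the @gen kernel
carry one extra power of `L`, cf. the READING of `B7Prop9General`). [cite: Balaban1985Averaging, (203)–(205) p.49] -/
def C4G (d L : ℕ) : ℝ :=
  2 * (32 * ((d : ℝ) + 1) ^ 2 * C6 d * L + 9 * C4' d + 768 * ((d : ℝ) + 1) * ((d : ℝ) + 4) * C7 d)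

/-- The right-hand side of **(203)** at a general background: `α₄Lʲη + C₄β(Lʲη)²`, `β = α₀α₄ + α₃α₄ + α₄²` (p. 49: "Let us denote
`β = α₀α₄ + α₃α₄ + α₄²`"), with `C₄ = C4G d L`. [cite: Balaban1985Averaging, (203) p.49] -/
def rhs203G (d L j : ℕ) (α₀ α₃ α₄ η : ℝ) : ℝ :=
  α₄ * ((L : ℝ) ^ j * η) + C4G d L * (α₀ * α₄ + α₃ * α₄ + α₄ ^ 2) * ((L : ℝ) ^ j * η) ^ 2

/-- The right-hand side of **(204)** at a general background: print's "`α₄ + 2C′₅α₄Lη + … + 2C′₅α₄Lʲη`" plus, at each level `i < j`,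
the `α₀`-term `8dC′₅C₆L²·α₀α₄(Lⁱη)²` of `B7Prop9General.eq200_general` applied at the background `Ū₀ⁱ` (`|Ū₀ⁱ(∂p) − 1| ≤ 2α₀(Lⁱη)²`).
[cite: Balaban1985Averaging, (204) p.49, (206) p.49] -/
def rhs204G (d L j : ℕ) (α₀ α₄ η : ℝ) : ℝ :=
  α₄ + ∑ i ∈ range j, (2 * C5' d * α₄ * ((L : ℝ) ^ (i + 1) * η) +
    8 * d * C5' d * C6 d * (L : ℝ) ^ 2 * α₀ * α₄ * ((L : ℝ) ^ i * η) ^ 2)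

omit [NormOneClass 𝔸] [NormedAlgebra ℂ 𝔸] [CompleteSpace 𝔸] in
/-- Signs of the constants. [folklore] -/
private theorem consts_nonneg : (0 : ℝ) ≤ C5' d ∧ (1 : ℝ) ≤ C5 d ∧ (2 : ℝ) ≤ C6 d ∧ (0 : ℝ) ≤ C4' d ∧ (3 : ℝ) ≤ C7 d := by
  refine ⟨C5'_nonneg, one_le_C5, ?_, C4'_nonneg, ?_⟩
  · unfold C6; linarith [one_le_C5 (d := d)]
  · unfold C7 C6; linarith [one_le_C5 (d := d), C5'_nonneg (d := d)]

/-- `C4G_ge`: the three coefficients are dominated by `C₄/2`. [cite: Balaban1985Averaging, (205) p.49] -/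
private theorem C4G_nonneg (d L : ℕ) : (0 : ℝ) ≤ C4G d L := by
  obtain ⟨h5', h5, h6, h4', h7⟩ := consts_nonneg (d := d)
  unfold C4G; positivity

/-- (203) at `j = 0` reads `α₄η + C₄βη²` (⊇ (177)). [cite: Balaban1985Averaging, (203) p.49, (177) p.45] -/
theorem rhs203G_zero (d L : ℕ) (α₀ α₃ α₄ η : ℝ) :
    rhs203G d L 0 α₀ α₃ α₄ η = α₄ * η + C4G d L * (α₀ * α₄ + α₃ * α₄ + α₄ ^ 2) * η ^ 2 := by
  simp [rhs203G]

/-- (204) at `j = 0` reads `α₄` (= (176)). [cite: Balaban1985Averaging, (204) p.49, (176) p.45] -/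
theorem rhs204G_zero (d L : ℕ) (α₀ α₄ η : ℝ) : rhs204G d L 0 α₀ α₄ η = α₄ := by simp [rhs204G]

/-- **(206)** at a general background, the bookkeeping identity: (204) at `j + 1` = (204) at `j` plus the level-`j` increment.
[cite: Balaban1985Averaging, (206) p.49] -/
theorem rhs204G_succ (d L j : ℕ) (α₀ α₄ η : ℝ) :
    rhs204G d L (j + 1) α₀ α₄ η = rhs204G d L j α₀ α₄ η +
      (2 * C5' d * α₄ * ((L : ℝ) ^ (j + 1) * η) + 8 * d * C5' d * C6 d * (L : ℝ) ^ 2 * α₀ * α₄ * ((L : ℝ) ^ j * η) ^ 2) := by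
  simp only [rhs204G, sum_range_succ]; ring

/-- p. 49: "`α₄` replaced by the right-hand side of (204), which can be bounded by `α₄(1 + 4C′₅) = C₅α₄`" — at a general
background by `C₆α₄ = (C₅ + 1)α₄`: `Lη + ⋯ + Lʲη ≤ 2Lʲη ≤ 2` (`L ≥ 2`, `Lʲη ≤ 1`) for print's sum, and `Σ_{i<j}(Lⁱη)² ≤ Σ_{i<j} Lⁱη ≤ 2`
with `16dC′₅C₆L²α₀ ≤ 1` for the `α₀`-increments. [cite: Balaban1985Averaging, (204) p.49] -/
theorem rhs204G_le {L : ℕ} (hL : 2 ≤ L) {j : ℕ} {α₀ α₄ η : ℝ} (hα₀ : 0 ≤ α₀) (hα₄ : 0 ≤ α₄) (hη : 0 ≤ η)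
    (ht : (L : ℝ) ^ j * η ≤ 1) (hs : 16 * d * C5' d * C6 d * (L : ℝ) ^ 2 * α₀ ≤ 1) :
    rhs204G d L j α₀ α₄ η ≤ C6 d * α₄ := by
  obtain ⟨h5', h5, h6, -, -⟩ := consts_nonneg (d := d)
  have hLr : (2 : ℝ) ≤ L := by exact_mod_cast hL
  have hd : (0 : ℝ) ≤ d := Nat.cast_nonneg d
  have hs1 := sum_pow_succ_le hLr 0 j
  simp only [zero_add] at hs1
  -- print's sum
  have hsum1 : ∑ i ∈ range j, (L : ℝ) ^ (i + 1) * η ≤ 2 * ((L : ℝ) ^ j * η) := by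
    rw [← sum_mul]; nlinarith
  -- the α₀-increments: `(Lⁱη)² ≤ Lⁱη ≤ L^{i+1}η/2`? — we use `(Lⁱη)² ≤ Lⁱη · 1` and `Σ Lⁱη ≤ Σ L^{i+1}η / 2 ≤ Lʲη`
  have hti : ∀ i ∈ range j, ((L : ℝ) ^ i * η) ^ 2 ≤ (L : ℝ) ^ (i + 1) * η / 2 := by
    intro i hi
    have hij : i ≤ j := (mem_range.mp hi).le
    have hL1 : (1 : ℝ) ≤ L := by linarith
    have hti1 : (L : ℝ) ^ i * η ≤ 1 :=
      (mul_le_mul_of_nonneg_right (pow_le_pow_right₀ hL1 hij) hη).trans ht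
    have hti0 : 0 ≤ (L : ℝ) ^ i * η := by positivity
    have h1 : ((L : ℝ) ^ i * η) ^ 2 ≤ (L : ℝ) ^ i * η := by nlinarith
    have h2 : (L : ℝ) ^ (i + 1) * η = L * ((L : ℝ) ^ i * η) := by ring
    have h3 : (L : ℝ) ^ i * η ≤ L * ((L : ℝ) ^ i * η) / 2 := by nlinarith
    rw [h2]; linarith
  have hsum2 : ∑ i ∈ range j, ((L : ℝ) ^ i * η) ^ 2 ≤ (L : ℝ) ^ j * η := by
    calc ∑ i ∈ range j, ((L : ℝ) ^ i * η) ^ 2 ≤ ∑ i ∈ range j, (L : ℝ) ^ (i + 1) * η / 2 := sum_le_sum hti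
      _ = (∑ i ∈ range j, (L : ℝ) ^ (i + 1) * η) / 2 := by rw [sum_div]
      _ ≤ (L : ℝ) ^ j * η := by linarith
  unfold rhs204G
  rw [sum_add_distrib, ← mul_sum, ← mul_sum]
  have e1 : 2 * C5' d * α₄ * ∑ i ∈ range j, (L : ℝ) ^ (i + 1) * η ≤ 2 * C5' d * α₄ * 2 :=
    mul_le_mul_of_nonneg_left (hsum1.trans (by linarith)) (by positivity)
  have e2 : 8 * d * C5' d * C6 d * (L : ℝ) ^ 2 * α₀ * α₄ * ∑ i ∈ range j, ((L : ℝ) ^ i * η) ^ 2 ≤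
      8 * d * C5' d * C6 d * (L : ℝ) ^ 2 * α₀ * α₄ * 1 :=
    mul_le_mul_of_nonneg_left (hsum2.trans ht) (by positivity)
  have e3 : 8 * d * C5' d * C6 d * (L : ℝ) ^ 2 * α₀ * α₄ ≤ α₄ := by
    have h8 : 8 * d * C5' d * C6 d * (L : ℝ) ^ 2 * α₀ ≤ 1 := by linarith [hs]
    have := mul_le_mul_of_nonneg_right h8 hα₄
    linarith
  have hC6 : C6 d * α₄ = α₄ + 2 * C5' d * α₄ * 2 + α₄ := by unfold C6 C5; ring
  rw [hC6]
  linarith [e1, e2, e3]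

/-- p. 49: "Let us notice that `α₄Lʲη + C₄β(Lʲη)² ≦ α₄Lʲη(1 + C₄(α₀ + α₃ + α₄)) ≦ 2α₄Lʲη ≦ 2α₄` for `α₀, α₃, α₄` sufficiently
small" — here under the explicit `C₄(α₀ + α₃ + α₄) ≤ 1` and `Lʲη ≤ 1`. [cite: Balaban1985Averaging, (203) p.49] -/
theorem rhs203G_le {L j : ℕ} {α₀ α₃ α₄ η : ℝ} (hα₄ : 0 ≤ α₄) (hη : 0 ≤ η)
    (ht : (L : ℝ) ^ j * η ≤ 1) (hC : C4G d L * (α₀ + α₃ + α₄) ≤ 1) :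
    rhs203G d L j α₀ α₃ α₄ η ≤ 2 * α₄ * ((L : ℝ) ^ j * η) := by
  unfold rhs203G
  set t := (L : ℝ) ^ j * η with ht_def
  have ht0 : 0 ≤ t := by positivity
  have h1 : C4G d L * (α₀ * α₄ + α₃ * α₄ + α₄ ^ 2) * t ^ 2 ≤ α₄ * t := by
    have : C4G d L * (α₀ * α₄ + α₃ * α₄ + α₄ ^ 2) * t ^ 2 = (C4G d L * (α₀ + α₃ + α₄)) * (α₄ * t) * t := by ring
    rw [this]
    have h2 : (C4G d L * (α₀ + α₃ + α₄)) * (α₄ * t) ≤ 1 * (α₄ * t) :=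
      mul_le_mul_of_nonneg_right hC (by positivity)
    calc C4G d L * (α₀ + α₃ + α₄) * (α₄ * t) * t ≤ 1 * (α₄ * t) * 1 :=
          mul_le_mul h2 ht ht0 (by positivity)
      _ = α₄ * t := by ring
  linarith

/-- The real-arithmetic core of (205) at a general background (all casts and constants abstracted): with `K` the constant
`C4G`, `c5′, c6, c7, c4′` the constants `C′₅, C₆, C₇, C′₄`, `D = d`, `Lr = L`, `t = Lʲη`. [cite: Balaban1985Averaging, (205) p.49] -/
private theorem step205_real {Lr t α₀ α₃ α₄ A T K c5' c6 c7 c4' D : ℝ}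
    (hL : 2 ≤ Lr) (ht0 : 0 ≤ t) (hLt : Lr * t ≤ 1) (hα₀ : 0 ≤ α₀) (hα₃ : 0 ≤ α₃) (hα₄ : 0 ≤ α₄)
    (hc5' : 0 ≤ c5') (hc6 : 2 ≤ c6) (hc7 : c7 = c6 + 2 * c5' + 1) (hc4' : 0 ≤ c4') (hD : 0 ≤ D)
    (hK : K = 2 * (32 * (D + 1) ^ 2 * c6 * Lr + 9 * c4' + 768 * (D + 1) * (D + 4) * c7))
    (hA0 : 0 ≤ A) (hA : A ≤ α₄ * t + K * (α₀ * α₄ + α₃ * α₄ + α₄ ^ 2) * t ^ 2) (hA2 : A ≤ 2 * α₄ * t)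
    (hT0 : 0 ≤ T) (hT : T ≤ c6 * α₄)
    (hs₅ : 32 * (D + 1) ^ 2 * c6 * Lr ^ 2 * α₀ ≤ 1) (hs₆ : 16 * D * c5' * c6 * Lr ^ 2 * α₀ ≤ 1) :
    (Lr * (A + 16 * (D + 1) ^ 2 * Lr ^ 2 * (2 * α₀ * t ^ 2) * T) +
        c4' * Lr ^ 2 * ((α₃ * t) * (A + 16 * (D + 1) ^ 2 * Lr ^ 2 * (2 * α₀ * t ^ 2) * T) +
          (A + 16 * (D + 1) ^ 2 * Lr ^ 2 * (2 * α₀ * t ^ 2) * T) ^ 2)) +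
      384 * (D + 1) * (D + 4) * Lr ^ 2 * (2 * α₀ * t ^ 2) * (T + c5' * Lr * (A + 4 * (D * Lr * (2 * α₀ * t ^ 2)) * T))
      ≤ α₄ * (Lr * t) + K * (α₀ * α₄ + α₃ * α₄ + α₄ ^ 2) * (Lr * t) ^ 2 := by
  have hL0 : 0 ≤ Lr := by linarith
  have ht1 : t ≤ 1 := by
    have h := mul_nonneg (show (0 : ℝ) ≤ Lr - 1 by linarith) ht0
    linarith only [h, hLt]
  have ht2 : t ^ 2 ≤ t := by
    have h := mul_nonneg ht0 (sub_nonneg.mpr ht1)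
    linarith only [h]
  have hc70 : 0 ≤ c7 := by rw [hc7]; linarith
  have hc60 : 0 ≤ c6 := by linarith
  have hK0 : 0 ≤ K := by rw [hK]; positivity
  -- β
  have hβ0 : 0 ≤ α₀ * α₄ + α₃ * α₄ + α₄ ^ 2 := by positivity
  have hβ1 : α₀ * α₄ ≤ α₀ * α₄ + α₃ * α₄ + α₄ ^ 2 := by
    have h1 := mul_nonneg hα₃ hα₄
    have h2 := sq_nonneg α₄
    linarith only [h1, h2]
  -- the extra piece g₂ := 16(D+1)²Lr²(2α₀t²)T = 32(D+1)²Lr²α₀·t²·T ≤ α₄ t² ≤ α₄ t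
  have hg1 : 16 * (D + 1) ^ 2 * Lr ^ 2 * (2 * α₀ * t ^ 2) * T ≤ α₄ * t ^ 2 := by
    have e : 16 * (D + 1) ^ 2 * Lr ^ 2 * (2 * α₀ * t ^ 2) * T = (32 * (D + 1) ^ 2 * Lr ^ 2 * α₀) * t ^ 2 * T := by ring
    have h1 : (32 * (D + 1) ^ 2 * Lr ^ 2 * α₀) * t ^ 2 * T ≤ (32 * (D + 1) ^ 2 * Lr ^ 2 * α₀) * t ^ 2 * (c6 * α₄) :=
      mul_le_mul_of_nonneg_left hT (by positivity)
    have h2 : (32 * (D + 1) ^ 2 * Lr ^ 2 * α₀) * t ^ 2 * (c6 * α₄) =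
        (32 * (D + 1) ^ 2 * c6 * Lr ^ 2 * α₀) * (t ^ 2 * α₄) := by ring
    have h3 : (32 * (D + 1) ^ 2 * c6 * Lr ^ 2 * α₀) * (t ^ 2 * α₄) ≤ 1 * (t ^ 2 * α₄) :=
      mul_le_mul_of_nonneg_right hs₅ (by positivity)
    rw [e]; linarith
  have hg0 : 0 ≤ 16 * (D + 1) ^ 2 * Lr ^ 2 * (2 * α₀ * t ^ 2) * T := by positivity
  -- abbreviate the step size a′ := A + g₂ (no `set`: we keep the explicit sum and bound it)
  have ha' : A + 16 * (D + 1) ^ 2 * Lr ^ 2 * (2 * α₀ * t ^ 2) * T ≤ 3 * α₄ * t := by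
    have : α₄ * t ^ 2 ≤ α₄ * t := mul_le_mul_of_nonneg_left ht2 hα₄
    linarith
  have ha'0 : 0 ≤ A + 16 * (D + 1) ^ 2 * Lr ^ 2 * (2 * α₀ * t ^ 2) * T := by positivity
  -- Term 1a: Lr·A ≤ α₄(Lr t) + Kβ(Lr t)²/2  (uses Lr ≥ 2)
  have e1a : Lr * A ≤ α₄ * (Lr * t) + K * (α₀ * α₄ + α₃ * α₄ + α₄ ^ 2) * (Lr * t) ^ 2 / 2 := by
    have h1 : Lr * (K * (α₀ * α₄ + α₃ * α₄ + α₄ ^ 2) * t ^ 2) ≤ K * (α₀ * α₄ + α₃ * α₄ + α₄ ^ 2) * (Lr * t) ^ 2 / 2 := by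
      have e : K * (α₀ * α₄ + α₃ * α₄ + α₄ ^ 2) * (Lr * t) ^ 2 / 2 - Lr * (K * (α₀ * α₄ + α₃ * α₄ + α₄ ^ 2) * t ^ 2)
          = K * (α₀ * α₄ + α₃ * α₄ + α₄ ^ 2) * t ^ 2 * (Lr * (Lr - 2) / 2) := by ring
      have h0 : 0 ≤ K * (α₀ * α₄ + α₃ * α₄ + α₄ ^ 2) * t ^ 2 * (Lr * (Lr - 2) / 2) := by
        apply mul_nonneg (by positivity)
        have : 0 ≤ Lr * (Lr - 2) := mul_nonneg hL0 (by linarith)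
        linarith
      linarith
    have h2 := mul_le_mul_of_nonneg_left hA hL0
    have h3 : Lr * (α₄ * t + K * (α₀ * α₄ + α₃ * α₄ + α₄ ^ 2) * t ^ 2) =
        α₄ * (Lr * t) + Lr * (K * (α₀ * α₄ + α₃ * α₄ + α₄ ^ 2) * t ^ 2) := by ring
    linarith
  -- Term 1b: Lr·g₂ ≤ 32(D+1)²c6·Lr·β(Lr t)²
  have e1b : Lr * (16 * (D + 1) ^ 2 * Lr ^ 2 * (2 * α₀ * t ^ 2) * T) ≤
      32 * (D + 1) ^ 2 * c6 * Lr * (α₀ * α₄ + α₃ * α₄ + α₄ ^ 2) * (Lr * t) ^ 2 := by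
    have e : Lr * (16 * (D + 1) ^ 2 * Lr ^ 2 * (2 * α₀ * t ^ 2) * T) = 32 * (D + 1) ^ 2 * Lr * (Lr * t) ^ 2 * (α₀ * T) := by
      ring
    have hαT : α₀ * T ≤ c6 * (α₀ * α₄ + α₃ * α₄ + α₄ ^ 2) := by
      have h1 : α₀ * T ≤ α₀ * (c6 * α₄) := mul_le_mul_of_nonneg_left hT hα₀
      have h2 : α₀ * (c6 * α₄) = c6 * (α₀ * α₄) := by ring
      have h3 : c6 * (α₀ * α₄) ≤ c6 * (α₀ * α₄ + α₃ * α₄ + α₄ ^ 2) := mul_le_mul_of_nonneg_left hβ1 (by linarith)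
      linarith
    have h0 : 0 ≤ 32 * (D + 1) ^ 2 * Lr * (Lr * t) ^ 2 := by positivity
    have h1 := mul_le_mul_of_nonneg_left hαT h0
    have h2 : 32 * (D + 1) ^ 2 * Lr * (Lr * t) ^ 2 * (c6 * (α₀ * α₄ + α₃ * α₄ + α₄ ^ 2)) =
        32 * (D + 1) ^ 2 * c6 * Lr * (α₀ * α₄ + α₃ * α₄ + α₄ ^ 2) * (Lr * t) ^ 2 := by ring
    rw [e]; linarith
  -- Term 2: c4′Lr²(α′₃a′ + a′²) ≤ 9c4′β(Lr t)²
  have e2 : c4' * Lr ^ 2 * ((α₃ * t) * (A + 16 * (D + 1) ^ 2 * Lr ^ 2 * (2 * α₀ * t ^ 2) * T) +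
      (A + 16 * (D + 1) ^ 2 * Lr ^ 2 * (2 * α₀ * t ^ 2) * T) ^ 2) ≤
        9 * c4' * (α₀ * α₄ + α₃ * α₄ + α₄ ^ 2) * (Lr * t) ^ 2 := by
    have h1 : (α₃ * t) * (A + 16 * (D + 1) ^ 2 * Lr ^ 2 * (2 * α₀ * t ^ 2) * T) ≤ 3 * (α₃ * α₄) * t ^ 2 := by
      have h := mul_le_mul_of_nonneg_left ha' (show 0 ≤ α₃ * t by positivity)
      have e : α₃ * t * (3 * α₄ * t) = 3 * (α₃ * α₄) * t ^ 2 := by ring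
      linarith
    have h2 : (A + 16 * (D + 1) ^ 2 * Lr ^ 2 * (2 * α₀ * t ^ 2) * T) ^ 2 ≤ 9 * α₄ ^ 2 * t ^ 2 := by
      have h := pow_le_pow_left₀ ha'0 ha' 2
      have e : (3 * α₄ * t) ^ 2 = 9 * α₄ ^ 2 * t ^ 2 := by ring
      linarith
    have h3 : 3 * (α₃ * α₄) * t ^ 2 + 9 * α₄ ^ 2 * t ^ 2 ≤ 9 * (α₀ * α₄ + α₃ * α₄ + α₄ ^ 2) * t ^ 2 := by
      have h31 : 0 ≤ α₀ * α₄ * t ^ 2 := by positivity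
      have h32 : 0 ≤ α₃ * α₄ * t ^ 2 := by positivity
      linarith only [h31, h32]
    have h4 := mul_le_mul_of_nonneg_left ((add_le_add h1 h2).trans h3) (show 0 ≤ c4' * Lr ^ 2 by positivity)
    have e : c4' * Lr ^ 2 * (9 * (α₀ * α₄ + α₃ * α₄ + α₄ ^ 2) * t ^ 2) =
        9 * c4' * (α₀ * α₄ + α₃ * α₄ + α₄ ^ 2) * (Lr * t) ^ 2 := by ring
    linarith
  -- Term 3: the `e^{X_c}` cost ≤ 768(D+1)(D+4)c7β(Lr t)²
  have e3 : 384 * (D + 1) * (D + 4) * Lr ^ 2 * (2 * α₀ * t ^ 2) *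
      (T + c5' * Lr * (A + 4 * (D * Lr * (2 * α₀ * t ^ 2)) * T)) ≤
        768 * (D + 1) * (D + 4) * c7 * (α₀ * α₄ + α₃ * α₄ + α₄ ^ 2) * (Lr * t) ^ 2 := by
    have hin1 : c5' * Lr * A ≤ 2 * c5' * α₄ := by
      have h1 : c5' * Lr * A ≤ c5' * Lr * (2 * α₄ * t) := mul_le_mul_of_nonneg_left hA2 (by positivity)
      have h2 : c5' * Lr * (2 * α₄ * t) = 2 * c5' * α₄ * (Lr * t) := by ring
      have h3 : 2 * c5' * α₄ * (Lr * t) ≤ 2 * c5' * α₄ * 1 := mul_le_mul_of_nonneg_left hLt (by positivity)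
      linarith
    have hin2 : c5' * Lr * (4 * (D * Lr * (2 * α₀ * t ^ 2)) * T) ≤ α₄ := by
      have e : c5' * Lr * (4 * (D * Lr * (2 * α₀ * t ^ 2)) * T) = (8 * D * c5' * Lr ^ 2 * α₀) * (t ^ 2 * T) := by ring
      have h1 : (8 * D * c5' * Lr ^ 2 * α₀) * (t ^ 2 * T) ≤ (8 * D * c5' * Lr ^ 2 * α₀) * (1 * (c6 * α₄)) := by
        exact mul_le_mul_of_nonneg_left (mul_le_mul (ht2.trans ht1) hT hT0 (by norm_num)) (by positivity)
      have h2 : (8 * D * c5' * Lr ^ 2 * α₀) * (1 * (c6 * α₄)) = (16 * D * c5' * c6 * Lr ^ 2 * α₀) * α₄ / 2 := by ring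
      have h3 : (16 * D * c5' * c6 * Lr ^ 2 * α₀) * α₄ ≤ 1 * α₄ := mul_le_mul_of_nonneg_right hs₆ hα₄
      rw [e]; linarith
    have hin : T + c5' * Lr * (A + 4 * (D * Lr * (2 * α₀ * t ^ 2)) * T) ≤ c7 * α₄ := by
      have e : c5' * Lr * (A + 4 * (D * Lr * (2 * α₀ * t ^ 2)) * T) =
          c5' * Lr * A + c5' * Lr * (4 * (D * Lr * (2 * α₀ * t ^ 2)) * T) := by ring
      rw [e, hc7]; linarith
    have h0 : 0 ≤ 384 * (D + 1) * (D + 4) * Lr ^ 2 * (2 * α₀ * t ^ 2) := by positivity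
    have h1 := mul_le_mul_of_nonneg_left hin h0
    have e : 384 * (D + 1) * (D + 4) * Lr ^ 2 * (2 * α₀ * t ^ 2) * (c7 * α₄) =
        768 * (D + 1) * (D + 4) * c7 * (α₀ * α₄) * (Lr * t) ^ 2 := by ring
    have h2 : 768 * (D + 1) * (D + 4) * c7 * (α₀ * α₄) * (Lr * t) ^ 2 ≤
        768 * (D + 1) * (D + 4) * c7 * (α₀ * α₄ + α₃ * α₄ + α₄ ^ 2) * (Lr * t) ^ 2 := by
      have h00 : 0 ≤ 768 * (D + 1) * (D + 4) * c7 * (Lr * t) ^ 2 := by positivity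
      have h02 := mul_le_mul_of_nonneg_left hβ1 h00
      linarith only [h02]
    linarith
  -- assemble: the three β-coefficients sum to K/2
  have hsum : 32 * (D + 1) ^ 2 * c6 * Lr * (α₀ * α₄ + α₃ * α₄ + α₄ ^ 2) * (Lr * t) ^ 2 +
      9 * c4' * (α₀ * α₄ + α₃ * α₄ + α₄ ^ 2) * (Lr * t) ^ 2 +
      768 * (D + 1) * (D + 4) * c7 * (α₀ * α₄ + α₃ * α₄ + α₄ ^ 2) * (Lr * t) ^ 2 =
        K * (α₀ * α₄ + α₃ * α₄ + α₄ ^ 2) * (Lr * t) ^ 2 / 2 := by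
    rw [hK]; ring
  have hsplit : Lr * (A + 16 * (D + 1) ^ 2 * Lr ^ 2 * (2 * α₀ * t ^ 2) * T) =
      Lr * A + Lr * (16 * (D + 1) ^ 2 * Lr ^ 2 * (2 * α₀ * t ^ 2) * T) := by ring
  rw [hsplit]
  linarith

/-- **(205) at a general background**: one step of `B7Prop9General.eq199_general` at the background `Ū₀ʲ` — with print's
substitutions "`α₀` replaced by `2α₀(Lʲη)²`, `α′₃` replaced by `α₃Lʲη`, `α₄` replaced by the right-hand side of (204)" (`≤ C₆α₄`), "`α′₄`
replaced by the right-hand side of (203)" (`≤ 2α₄Lʲη`) — is again of the form (203) at the next scale: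
`B₁₉₉ ≤ α₄L^{j+1}η + C₄β(L^{j+1}η)²` (print: "`< α₄L^{j+1}η + LC₄β(Lʲη)² + C′₄(2α₀C₅α₄ + α₃2α₄ + 4α₄²)(L^{j+1}η)² < … ≦ α₄L^{j+1}η +
C₄β(L^{j+1}η)²`"), for `L ≥ 2` and under `C₄(α₀ + α₃ + α₄) ≤ 1`, `32(d+1)²C₆L²α₀ ≤ 1`, `16dC′₅C₆L²α₀ ≤ 1`.
[cite: Balaban1985Averaging, (205) p.49] -/
theorem ineq205G {L : ℕ} (hL : 2 ≤ L) {j : ℕ} {α₀ α₃ α₄ η A T : ℝ} (hα₀ : 0 ≤ α₀) (hα₃ : 0 ≤ α₃) (hα₄ : 0 ≤ α₄)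
    (hη : 0 ≤ η) (ht : (L : ℝ) ^ j * η ≤ 1) (hLt : (L : ℝ) ^ (j + 1) * η ≤ 1) (hC : C4G d L * (α₀ + α₃ + α₄) ≤ 1)
    (hs₅ : 32 * ((d : ℝ) + 1) ^ 2 * C6 d * (L : ℝ) ^ 2 * α₀ ≤ 1) (hs₆ : 16 * d * C5' d * C6 d * (L : ℝ) ^ 2 * α₀ ≤ 1)
    (hA0 : 0 ≤ A) (hA : A ≤ rhs203G d L j α₀ α₃ α₄ η) (hT0 : 0 ≤ T) (hT : T ≤ C6 d * α₄) :
    (L * (A + 16 * ((d : ℝ) + 1) ^ 2 * L ^ 2 * (2 * α₀ * ((L : ℝ) ^ j * η) ^ 2) * T) +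
        C4' d * L ^ 2 * ((α₃ * ((L : ℝ) ^ j * η)) * (A + 16 * ((d : ℝ) + 1) ^ 2 * L ^ 2 * (2 * α₀ * ((L : ℝ) ^ j * η) ^ 2) * T) +
          (A + 16 * ((d : ℝ) + 1) ^ 2 * L ^ 2 * (2 * α₀ * ((L : ℝ) ^ j * η) ^ 2) * T) ^ 2)) +
      384 * ((d : ℝ) + 1) * ((d : ℝ) + 4) * L ^ 2 * (2 * α₀ * ((L : ℝ) ^ j * η) ^ 2) *
        (T + C5' d * L * (A + 4 * (d * L * (2 * α₀ * ((L : ℝ) ^ j * η) ^ 2)) * T))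
      ≤ rhs203G d L (j + 1) α₀ α₃ α₄ η := by
  obtain ⟨h5', h5, h6, h4', h7⟩ := consts_nonneg (d := d)
  have hLr : (2 : ℝ) ≤ L := by exact_mod_cast hL
  have hd : (0 : ℝ) ≤ d := Nat.cast_nonneg d
  have ht0 : 0 ≤ (L : ℝ) ^ j * η := by positivity
  have hLt' : (L : ℝ) * ((L : ℝ) ^ j * η) ≤ 1 := by rw [← mul_assoc, ← pow_succ']; exact hLt
  have hA2 : A ≤ 2 * α₄ * ((L : ℝ) ^ j * η) := hA.trans (rhs203G_le (d := d) hα₄ hη ht hC)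
  have hsucc : rhs203G d L (j + 1) α₀ α₃ α₄ η =
      α₄ * (L * ((L : ℝ) ^ j * η)) + C4G d L * (α₀ * α₄ + α₃ * α₄ + α₄ ^ 2) * (L * ((L : ℝ) ^ j * η)) ^ 2 := by
    unfold rhs203G; ring
  rw [hsucc]
  exact step205_real hLr ht0 hLt' hα₀ hα₃ hα₄ h5' h6 rfl h4' hd rfl hA0 (by unfold rhs203G at hA; exact hA) hA2 hT0 hT
    hs₅ hs₆

/-- **(206) at a general background**: the site constant of one step of `B7Prop9General.eq200_general` at the background `Ū₀ʲ`,
`(204)ⱼ + C′₅L((203)ⱼ + 4dL·2α₀(Lʲη)²·(204)ⱼ)`, is at most (204) at `j + 1` (print: "`|ũ′^{j+1}(y) − 1| < α₄ + 2C′₅α₄Lη + … +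
2C′₅α₄L^{j+1}η`. (206)"). [cite: Balaban1985Averaging, (206) p.49] -/
theorem ineq206G {L : ℕ} {j : ℕ} {α₀ α₃ α₄ η A : ℝ} (hα₀ : 0 ≤ α₀) (hα₄ : 0 ≤ α₄)
    (hη : 0 ≤ η) (ht : (L : ℝ) ^ j * η ≤ 1) (hC : C4G d L * (α₀ + α₃ + α₄) ≤ 1)
    (hs₆ : 16 * d * C5' d * C6 d * (L : ℝ) ^ 2 * α₀ ≤ 1) (hL : 2 ≤ L)
    (hA : A ≤ rhs203G d L j α₀ α₃ α₄ η) :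
    rhs204G d L j α₀ α₄ η + C5' d * L * (A + 4 * (d * L * (2 * α₀ * ((L : ℝ) ^ j * η) ^ 2)) * rhs204G d L j α₀ α₄ η)
      ≤ rhs204G d L (j + 1) α₀ α₄ η := by
  obtain ⟨h5', h5, h6, h4', h7⟩ := consts_nonneg (d := d)
  have hd : (0 : ℝ) ≤ d := Nat.cast_nonneg d
  set t := (L : ℝ) ^ j * η with ht_def
  have ht0 : 0 ≤ t := by positivity
  have hT := rhs204G_le (d := d) hL hα₀ hα₄ hη ht hs₆
  have hT0 : 0 ≤ rhs204G d L j α₀ α₄ η := by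
    unfold rhs204G; apply add_nonneg hα₄; apply sum_nonneg; intro i _; positivity
  have hA2 : A ≤ 2 * α₄ * t := hA.trans (rhs203G_le (d := d) hα₄ hη ht hC)
  rw [rhs204G_succ]
  have e1 : C5' d * L * A ≤ 2 * C5' d * α₄ * ((L : ℝ) ^ (j + 1) * η) := by
    calc C5' d * L * A ≤ C5' d * L * (2 * α₄ * t) := by gcongr
      _ = 2 * C5' d * α₄ * ((L : ℝ) ^ (j + 1) * η) := by rw [ht_def]; ring
  have e2 : C5' d * L * (4 * (d * L * (2 * α₀ * t ^ 2)) * rhs204G d L j α₀ α₄ η) ≤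
      8 * d * C5' d * C6 d * (L : ℝ) ^ 2 * α₀ * α₄ * t ^ 2 := by
    have : C5' d * L * (4 * (d * L * (2 * α₀ * t ^ 2)) * rhs204G d L j α₀ α₄ η) =
        (8 * d * C5' d * (L : ℝ) ^ 2 * α₀ * t ^ 2) * rhs204G d L j α₀ α₄ η := by ring
    rw [this]
    calc _ ≤ (8 * d * C5' d * (L : ℝ) ^ 2 * α₀ * t ^ 2) * (C6 d * α₄) :=
          mul_le_mul_of_nonneg_left hT (by positivity)
      _ = 8 * d * C5' d * C6 d * (L : ℝ) ^ 2 * α₀ * α₄ * t ^ 2 := by ring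
  have : C5' d * L * (A + 4 * (d * L * (2 * α₀ * t ^ 2)) * rhs204G d L j α₀ α₄ η) =
      C5' d * L * A + C5' d * L * (4 * (d * L * (2 * α₀ * t ^ 2)) * rhs204G d L j α₀ α₄ η) := by ring
  rw [this]
  linarith

/-! ## §3 Proposition 10 at a general background -/

/-- **PROPOSITION 10 AT A GENERAL BACKGROUND** (p. 50: "**Proposition 10.** There exist positive constants `C₄, C₅, c₆` such that
for arbitrary configurations `U₀, u′, u₁` satisfying (52), (176), (177), (166), (167) with `α₀, α₃, α₄ ≦ c₆` the bounds (203), (204)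
hold for `j ≦ k`."), kernel form over the concrete model with EXPLICIT constants, proved by PRINT'S INDUCTION (p. 49: "We assume
them for some `j` and we will prove them for `j + 1`. We apply Proposition 9 with `V₀ = Ū₀ʲ, v′ = ũ′ʲ, v₁ = \overline{R₀u₁}ʲ`. We have
`α₀` replaced by `2α₀(Lʲη)²`, `α′₃` replaced by `α₃Lʲη`, `α₄` replaced by the right-hand side of (204) …, and `α′₄` replaced by the
right-hand side of (203) …"), each step being `B7Prop9General.prop9_general` at the averaged background `Ū₀ʲ = avgIter L U₀ j`, closed
by `ineq205G`/`ineq206G`.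
HYPOTHESES.  The outputs of Proposition 2 along the levels as DISPLAYED hypotheses: `hV` — `Ū₀ʲ`, `j < k`, with values in `U1`
(for `G`-valued `U₀`, `G` closed under the average: `B7Prop2Explicit.avgIter_mem`), `h52` — "`α₀` replaced by `2α₀(Lʲη)²`":
`‖Ū₀ʲ(∂p) − 1‖ ≤ 2α₀(Lʲη)²` on all unit plaquettes of level `j < k` (from (52) by `B7Prop2Explicit.prop2_explicit`; see
`prop10_general_of52` for the discharge); (176) `SiteBd u′ α₄`; (177) AT `U₀`: `CovBondBd U₀ u′ (α₄η)`; (166)–(167):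
`u₁ ∈ Λ_k(U₀, α₃)` = `B7Eq167Flat.InLambda L U₀ u₁ k α₃ η`; `L ≥ 2`, `0 ≤ η`, `Lᵏη ≤ 1`; explicit smallness in place of `c₆`:
`0 ≤ α₃ ≤ 1/50`, `0 ≤ α₄`, `10C₆α₄ ≤ 1`, `3·10³(d+1)Lα₄ ≤ 1`, `C₄(α₀ + α₃ + α₄) ≤ 1`, `0 ≤ α₀`, `1024(d+1)(d+4)L²α₀ ≤ 1`,
`32(d+1)²C₆L²α₀ ≤ 1`, `16dC′₅C₆L²α₀ ≤ 1`.
CONCLUSION: for every `j ≤ k`, **(203)** `CovBondBd (Ū₀ʲ) (ũ′ʲ) (α₄Lʲη + C₄β(Lʲη)²)` — i.e.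
`‖ũ′ʲ(c₋)⁻¹R̄ʲ_{0,c}ũ′ʲ(c₊) − 1‖ ≤ α₄Lʲη + C₄β(Lʲη)²` on all bonds `c` of `Ω^{(j)}`, `β = α₀α₄ + α₃α₄ + α₄²`, `C₄ = C4G d L` — and
**(204)** `SiteBd (ũ′ʲ) (rhs204G j)` (`≤ C₆α₄`, `rhs204G_le`), where `ũ′ʲ = utilG L U₀ u′ u₁ j` ((179) at `U₀`).  At `U₀ = 1` this is
`B7Prop10Flat.prop10_flat` up to the constants (`utilG_one_left`, `avgIter_one`).  READING: constants `C₄ = C₄(d, L)`, `C₆ = C₅ + 1`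
in place of print's `C₄ = 8C′₄C₅`, `C₅` (the `α₀`-terms of the @gen one-step kernel are `d`-dependent and one power of `L` weaker than
print's, cf. `B7Prop9General`); `c₆ = c₆(d, L)` as print allows.
[cite: Balaban1985Averaging, Proposition 10 p.50, (201)–(206) p.49, (176)–(179) p.45, (166)–(167) p.44, (52) p.26] -/
theorem prop10_general {L : ℕ} (hL : 2 ≤ L) {U₀ : Site d → Fin d → 𝔸ˣ} {k : ℕ} {u' u₁ : Site d → 𝔸ˣ}
    {α₀ α₃ α₄ η : ℝ}
    (hV : ∀ j < k, ∀ (x : Site d) (κ : Fin d), avgIter L U₀ j x κ ∈ U1 𝔸)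
    (h52 : ∀ j < k, ∀ (x : Site d) (κ μ : Fin d), κ ≠ μ →
      ‖((hol (avgIter L U₀ j) x (plaqWord κ μ) : 𝔸ˣ) : 𝔸) - 1‖ ≤ 2 * α₀ * ((L : ℝ) ^ j * η) ^ 2)
    (h176 : SiteBd u' α₄) (h177 : CovBondBd U₀ u' (α₄ * η)) (hu₁ : InLambda L U₀ u₁ k α₃ η)
    (hη : 0 ≤ η) (hk : (L : ℝ) ^ k * η ≤ 1) (hα₀ : 0 ≤ α₀) (hα₃ : 0 ≤ α₃) (hα₃' : α₃ ≤ 1 / 50) (hα₄ : 0 ≤ α₄)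
    (hs₁ : 10 * C6 d * α₄ ≤ 1) (hs₂ : 3000 * ((d : ℝ) + 1) * L * α₄ ≤ 1) (hs₃ : C4G d L * (α₀ + α₃ + α₄) ≤ 1)
    (hs₄ : 1024 * ((d : ℝ) + 1) * ((d : ℝ) + 4) * L ^ 2 * α₀ ≤ 1) (hs₅ : 32 * ((d : ℝ) + 1) ^ 2 * C6 d * L ^ 2 * α₀ ≤ 1)
    (hs₆ : 16 * d * C5' d * C6 d * (L : ℝ) ^ 2 * α₀ ≤ 1) :
    ∀ j ≤ k, CovBondBd (avgIter L U₀ j) (utilG L U₀ u' u₁ j) (rhs203G d L j α₀ α₃ α₄ η) ∧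
      SiteBd (utilG L U₀ u' u₁ j) (rhs204G d L j α₀ α₄ η) := by
  obtain ⟨h5', h5, h6, h4', h7⟩ := consts_nonneg (d := d)
  have hL1 : 1 ≤ L := le_trans (by norm_num) hL
  have hLr : (2 : ℝ) ≤ L := by exact_mod_cast hL
  have hd : (0 : ℝ) ≤ d := Nat.cast_nonneg d
  have hC4G := C4G_nonneg d L
  have h167 : ∀ j < k, ∀ (z : Site d) (r : Fin d → Fin L),
      ‖((((uavg L U₀ u₁ j ((L : ℤ) • z))⁻¹ *
          R0fun (avgIter L U₀ j) ((L : ℤ) • z) (uavg L U₀ u₁ j) ((L : ℤ) • z + boxVec L r) : 𝔸ˣ)) : 𝔸) - 1‖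
        ≤ α₃ * (L : ℝ) ^ (j + 1) * η := by
    have h := hu₁.2
    simp only [Cond167, R0fun_add] at h ⊢
    exact h
  intro j hj
  induction j with
  | zero =>
    refine ⟨?_, ?_⟩
    · rw [utilG_zero, avgIter_zero, rhs203G_zero]
      refine covBondBd_mono h177 ?_
      have : 0 ≤ C4G d L * (α₀ * α₄ + α₃ * α₄ + α₄ ^ 2) * η ^ 2 := by positivity
      linarith
    · rw [utilG_zero, rhs204G_zero]; exact h176
  | succ j ih =>
    have hjk : j < k := hj
    obtain ⟨hB, hS⟩ := ih hjk.le
    -- the scale parameter `t = Lʲη ≤ 1`, and `L t ≤ 1`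
    have ht := (pow_eta_le hL1 hη hk hjk.le).1
    have hLt : (L : ℝ) ^ (j + 1) * η ≤ 1 := (pow_eta_le hL1 hη hk (Nat.succ_le_of_lt hjk)).1
    have hLt' : (L : ℝ) * ((L : ℝ) ^ j * η) ≤ 1 := by rw [← mul_assoc, ← pow_succ']; exact hLt
    have ht0 : 0 ≤ (L : ℝ) ^ j * η := by positivity
    set t := (L : ℝ) ^ j * η with ht_def
    have hA := rhs203G_le (d := d) hα₄ hη ht hs₃
    have hA0 : 0 ≤ rhs203G d L j α₀ α₃ α₄ η := by unfold rhs203G; positivity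
    have hT := rhs204G_le (d := d) hL hα₀ hα₄ hη ht hs₆
    have hT0 : 0 ≤ rhs204G d L j α₀ α₄ η := (norm_nonneg _).trans (hS 0)
    -- level-`j` data
    set V : Site d → Fin d → 𝔸ˣ := avgIter L U₀ j with hVdef
    set α₀j : ℝ := 2 * α₀ * t ^ 2 with hα₀j
    have hα₀j0 : 0 ≤ α₀j := by positivity
    have hVU : ∀ x κ, V x κ ∈ U1 𝔸 := hV j hjk
    have h44 : ∀ (x : Site d) (κ μ : Fin d), κ ≠ μ → ‖((hol V x (plaqWord κ μ) : 𝔸ˣ) : 𝔸) - 1‖ ≤ α₀j :=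
      fun x κ μ hκμ => h52 j hjk x κ μ hκμ
    -- hypotheses (180) of Proposition 9 at step `j`
    have h3c : SiteBd (uavg L U₀ u₁ j) α₃ := fun z => hu₁.1 j hjk.le z
    have h3d : CovBlockBd L V (uavg L U₀ u₁ j) (L * (α₃ * t)) := by
      intro z r
      have := h167 j hjk z r
      calc _ ≤ α₃ * (L : ℝ) ^ (j + 1) * η := this
        _ = L * (α₃ * t) := by rw [ht_def]; ring
    have hq : 50 * (L * (α₃ * t)) ≤ 1 := by
      have e : L * (α₃ * t) = α₃ * (L * t) := by ring
      have h1 : α₃ * (L * t) ≤ α₃ * 1 := mul_le_mul_of_nonneg_left hLt' hα₃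
      rw [e]; linarith
    have hα₄j : rhs204G d L j α₀ α₄ η ≤ 1 / 10 := hT.trans (by linarith)
    -- the smallness of Proposition 9 at step `j`
    have ht2 : t ^ 2 ≤ t := by nlinarith
    have hg : 16 * ((d : ℝ) + 1) ^ 2 * L ^ 2 * α₀j * rhs204G d L j α₀ α₄ η ≤ α₄ * t := by
      have e : 16 * ((d : ℝ) + 1) ^ 2 * L ^ 2 * α₀j * rhs204G d L j α₀ α₄ η =
          (32 * ((d : ℝ) + 1) ^ 2 * L ^ 2 * α₀) * t ^ 2 * rhs204G d L j α₀ α₄ η := by rw [hα₀j]; ring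
      have h1 : (32 * ((d : ℝ) + 1) ^ 2 * L ^ 2 * α₀) * t ^ 2 * rhs204G d L j α₀ α₄ η ≤
          (32 * ((d : ℝ) + 1) ^ 2 * L ^ 2 * α₀) * t ^ 2 * (C6 d * α₄) :=
        mul_le_mul_of_nonneg_left hT (by positivity)
      have h2 : (32 * ((d : ℝ) + 1) ^ 2 * L ^ 2 * α₀) * t ^ 2 * (C6 d * α₄) =
          (32 * ((d : ℝ) + 1) ^ 2 * C6 d * L ^ 2 * α₀) * (t ^ 2 * α₄) := by ring
      have h3 : (32 * ((d : ℝ) + 1) ^ 2 * C6 d * L ^ 2 * α₀) * (t ^ 2 * α₄) ≤ 1 * (t ^ 2 * α₄) :=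
        mul_le_mul_of_nonneg_right hs₅ (by positivity)
      have h4 : t ^ 2 * α₄ ≤ t * α₄ := mul_le_mul_of_nonneg_right ht2 hα₄
      rw [e]; linarith
    have hs : 1000 * ((d : ℝ) + 1) * L *
        (rhs203G d L j α₀ α₃ α₄ η + 16 * ((d : ℝ) + 1) ^ 2 * L ^ 2 * α₀j * rhs204G d L j α₀ α₄ η) ≤ 1 := by
      have h1 : rhs203G d L j α₀ α₃ α₄ η + 16 * ((d : ℝ) + 1) ^ 2 * L ^ 2 * α₀j * rhs204G d L j α₀ α₄ η ≤ 3 * α₄ * t := by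
        linarith
      have h0 : 0 ≤ 1000 * ((d : ℝ) + 1) * L := by positivity
      have h2 := mul_le_mul_of_nonneg_left h1 h0
      have h3 : 1000 * ((d : ℝ) + 1) * L * (3 * α₄ * t) = 3000 * ((d : ℝ) + 1) * L * α₄ * t := by ring
      have h4 : 3000 * ((d : ℝ) + 1) * L * α₄ * t ≤ 3000 * ((d : ℝ) + 1) * L * α₄ * 1 := by
        have : 0 ≤ 3000 * ((d : ℝ) + 1) * L * α₄ := by positivity
        exact mul_le_mul_of_nonneg_left ht this
      linarith
    have hα₀s : 512 * ((d : ℝ) + 1) * ((d : ℝ) + 4) * L ^ 2 * α₀j ≤ 1 := by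
      have : 512 * ((d : ℝ) + 1) * ((d : ℝ) + 4) * L ^ 2 * α₀j =
          1024 * ((d : ℝ) + 1) * ((d : ℝ) + 4) * L ^ 2 * α₀ * t ^ 2 := by rw [hα₀j]; ring
      rw [this]
      have h0 : 0 ≤ 1024 * ((d : ℝ) + 1) * ((d : ℝ) + 4) * (L : ℝ) ^ 2 * α₀ := by positivity
      linarith [mul_le_mul_of_nonneg_left (ht2.trans ht) h0]
    -- Proposition 9 at step `j`
    have h9 := prop9_general hL1 hVU hα₀j0 h44 hS hB h3c h3d hα₄j hA0 (hα₃'.trans (by norm_num)) hq hs hα₀s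
    have eV : rescale L (bavg L V) = avgIter L U₀ (j + 1) := by rw [hVdef, avgIter_succ]
    have eU : (fun z => vtilG L V (utilG L U₀ u' u₁ j) (uavg L U₀ u₁ j) ((L : ℤ) • z)) = utilG L U₀ u' u₁ (j + 1) := by
      rw [utilG_succ]
    rw [eV, eU] at h9
    refine ⟨covBondBd_mono h9.1 ?_, siteBd_mono h9.2 ?_⟩
    · -- (205)
      have := ineq205G (d := d) hL hα₀ hα₃ hα₄ hη ht hLt hs₃ hs₅ hs₆ hA0 le_rfl hT0 hT
      rw [hα₀j]
      exact this
    · -- (206)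
      have := ineq206G (d := d) hα₀ hα₄ hη ht hs₃ hs₆ hL le_rfl
      rw [hα₀j]
      exact this

/-- **Proposition 10 at a general background, closed form** (p. 49: the right-hand side of (204) "can be bounded by `α₄(1 + 4C′₅) =
C₅α₄`", that of (203) "by `2α₄`" — here `C₆α₄` and `2α₄Lʲη`; p. 50: "This result implies in particular that the configuration `u′`
belongs to the class `Λ_k(C₅α₄)`"): under the hypotheses of `prop10_general`, for all `j ≤ k`,
`‖ũ′ʲ(c₋)⁻¹R̄ʲ_{0,c}ũ′ʲ(c₊) − 1‖ ≤ 2α₄Lʲη` and `‖ũ′ʲ − 1‖ ≤ C₆α₄`. [cite: Balaban1985Averaging, Proposition 10 p.50, (203)–(204) p.49] -/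
theorem prop10_general' {L : ℕ} (hL : 2 ≤ L) {U₀ : Site d → Fin d → 𝔸ˣ} {k : ℕ} {u' u₁ : Site d → 𝔸ˣ}
    {α₀ α₃ α₄ η : ℝ}
    (hV : ∀ j < k, ∀ (x : Site d) (κ : Fin d), avgIter L U₀ j x κ ∈ U1 𝔸)
    (h52 : ∀ j < k, ∀ (x : Site d) (κ μ : Fin d), κ ≠ μ →
      ‖((hol (avgIter L U₀ j) x (plaqWord κ μ) : 𝔸ˣ) : 𝔸) - 1‖ ≤ 2 * α₀ * ((L : ℝ) ^ j * η) ^ 2)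
    (h176 : SiteBd u' α₄) (h177 : CovBondBd U₀ u' (α₄ * η)) (hu₁ : InLambda L U₀ u₁ k α₃ η)
    (hη : 0 ≤ η) (hk : (L : ℝ) ^ k * η ≤ 1) (hα₀ : 0 ≤ α₀) (hα₃ : 0 ≤ α₃) (hα₃' : α₃ ≤ 1 / 50) (hα₄ : 0 ≤ α₄)
    (hs₁ : 10 * C6 d * α₄ ≤ 1) (hs₂ : 3000 * ((d : ℝ) + 1) * L * α₄ ≤ 1) (hs₃ : C4G d L * (α₀ + α₃ + α₄) ≤ 1)
    (hs₄ : 1024 * ((d : ℝ) + 1) * ((d : ℝ) + 4) * L ^ 2 * α₀ ≤ 1) (hs₅ : 32 * ((d : ℝ) + 1) ^ 2 * C6 d * L ^ 2 * α₀ ≤ 1)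
    (hs₆ : 16 * d * C5' d * C6 d * (L : ℝ) ^ 2 * α₀ ≤ 1) :
    ∀ j ≤ k, CovBondBd (avgIter L U₀ j) (utilG L U₀ u' u₁ j) (2 * α₄ * ((L : ℝ) ^ j * η)) ∧
      SiteBd (utilG L U₀ u' u₁ j) (C6 d * α₄) := by
  intro j hj
  have hL1 : 1 ≤ L := le_trans (by norm_num) hL
  have ht := (pow_eta_le hL1 hη hk hj).1
  obtain ⟨hB, hS⟩ := prop10_general hL hV h52 h176 h177 hu₁ hη hk hα₀ hα₃ hα₃' hα₄ hs₁ hs₂ hs₃ hs₄ hs₅ hs₆ j hj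
  exact ⟨covBondBd_mono hB (rhs203G_le hα₄ hη ht hs₃), siteBd_mono hS (rhs204G_le hL hα₀ hα₄ hη ht hs₆)⟩


/-! ## §4 The displayed level hypotheses from (52): Proposition 2 along the levels -/

/-- **Proposition 2 supplies the level hypotheses of `prop10_general`** (p. 49: "We have `α₀` replaced by `2α₀(Lʲη)²`", `η = L^{−k}`;
p. 26 (52)–(54)): for a background `U₀` with values in a subgroup `G ⊂ U1` closed under the average (42)/(43)
(`B7Prop2Explicit.AvgClosed`, e.g. the unitary group, `avgClosed_unitaryUnits`) satisfying (52) `sup_p‖U₀(∂p) − 1‖ < α₀η²` with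
`C₀α₀ ≤ ⅓`, `2α₀ ≤ c′₂` (Prop. 2's smallness), every averaged background `Ū₀ʲ`, `j ≤ k`, is `G`-valued (hence in `U1`) and satisfies
`‖Ū₀ʲ(∂p) − 1‖ ≤ 2(α₀(Lʲη)²)` on all unit plaquettes — Proposition 2 (`B7Prop2Explicit.prop2_explicit`) applied with `k := j` and
`α₀ := α₀(Lʲη)²` (then (52) reads `sup‖U₀(∂p) − 1‖ < (α₀(Lʲη)²)·L^{−2j}`). [cite: Balaban1985Averaging, Proposition 2 (52)–(54) p.26, p.49] -/
theorem levels_of52 {L : ℕ} (hL : 2 ≤ L) {G : Subgroup 𝔸ˣ} (hG : AvgClosed d L G) {U₀ : Site d → Fin d → 𝔸ˣ}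
    (hU : ∀ x κ, U₀ x κ ∈ G) (k : ℕ) {α₀ : ℝ} (hα : 0 < α₀) (hα3 : C0 d * α₀ ≤ 1 / 3) (hα2 : 2 * α₀ ≤ c2' d L)
    (h52 : pdev U₀ < α₀ * (((L : ℝ) ^ k)⁻¹) ^ 2) :
    (∀ j ≤ k, ∀ (x : Site d) (κ : Fin d), avgIter L U₀ j x κ ∈ U1 𝔸) ∧
      ∀ j ≤ k, ∀ (x : Site d) (κ μ : Fin d), κ ≠ μ →
        ‖((hol (avgIter L U₀ j) x (plaqWord κ μ) : 𝔸ˣ) : 𝔸) - 1‖ ≤ 2 * α₀ * ((L : ℝ) ^ j * ((L : ℝ) ^ k)⁻¹) ^ 2 := by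
  have hL1 : 1 ≤ L := le_trans (by norm_num) hL
  have hLr : (1 : ℝ) ≤ L := by exact_mod_cast hL1
  have hC0 := C0_pos d
  have key : ∀ j ≤ k, pdev (avgIter L U₀ j) < 2 * (α₀ * ((L : ℝ) ^ j * ((L : ℝ) ^ k)⁻¹) ^ 2) ∧
      ∀ i ≤ j, ∀ (x : Site d) (κ : Fin d), avgIter L U₀ i x κ ∈ G := by
    intro j hj
    set t : ℝ := (L : ℝ) ^ j * ((L : ℝ) ^ k)⁻¹ with ht
    have hLj : (0 : ℝ) < (L : ℝ) ^ j := by positivity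
    have hLk : (0 : ℝ) < (L : ℝ) ^ k := by positivity
    have ht0 : 0 < t := by positivity
    have ht1 : t ≤ 1 := by
      rw [ht, ← div_eq_mul_inv, div_le_one hLk]
      exact pow_le_pow_right₀ hLr hj
    have hα' : 0 < α₀ * t ^ 2 := by positivity
    have hαle : α₀ * t ^ 2 ≤ α₀ := by
      have : t ^ 2 ≤ 1 := by nlinarith
      nlinarith
    have hα3' : C0 d * (α₀ * t ^ 2) ≤ 1 / 3 := by nlinarith
    have hα2' : 2 * (α₀ * t ^ 2) ≤ c2' d L := by linarith
    have h52' : pdev U₀ < α₀ * t ^ 2 * (((L : ℝ) ^ j)⁻¹) ^ 2 := by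
      have e : α₀ * t ^ 2 * (((L : ℝ) ^ j)⁻¹) ^ 2 = α₀ * (((L : ℝ) ^ k)⁻¹) ^ 2 := by
        rw [ht]; field_simp
      rw [e]; exact h52
    obtain ⟨hp, hmem⟩ := prop2_explicit L hL hG j U₀ hU hα' hα3' hα2' h52'
    exact ⟨hp.trans (B7.prop2_bound_lt_two_alpha (C0 d) _ hα' hα3'), hmem⟩
  refine ⟨fun j hj x κ => hG.le_U1 ((key j hj).2 j le_rfl x κ), fun j hj x κ μ _ => ?_⟩
  have hU1 : ∀ (x : Site d) (κ : Fin d), avgIter L U₀ j x κ ∈ U1 𝔸 := fun x κ => hG.le_U1 ((key j hj).2 j le_rfl x κ)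
  have := (le_pdev hU1 x κ μ).trans (key j hj).1.le
  linarith

/-- **PROPOSITION 10 AT A GENERAL BACKGROUND UNDER (52)** — `prop10_general` with its level hypotheses DISCHARGED by Proposition 2
(`levels_of52`): for `U₀` with values in an average-closed subgroup `G ⊂ U1` (e.g. `unitaryUnits 𝔸`) satisfying (52)
`sup_p‖U₀(∂p) − 1‖ < α₀η²`, `η = L^{−k}`, and `u′, u₁` with (176), (177), (166)–(167), the bounds (203)/(204) (closed forms `2α₄Lʲη`,
`C₆α₄`) hold for all `j ≤ k`.  Smallness: that of `prop10_general` plus Prop. 2's `C₀α₀ ≤ ⅓`, `2α₀ ≤ c′₂`.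
[cite: Balaban1985Averaging, Proposition 10 p.50, Proposition 2 p.26, (201)–(206) p.49] -/
theorem prop10_general_of52 {L : ℕ} (hL : 2 ≤ L) {G : Subgroup 𝔸ˣ} (hG : AvgClosed d L G) {U₀ : Site d → Fin d → 𝔸ˣ}
    (hU : ∀ x κ, U₀ x κ ∈ G) {k : ℕ} {u' u₁ : Site d → 𝔸ˣ} {α₀ α₃ α₄ : ℝ}
    (hα : 0 < α₀) (hα3 : C0 d * α₀ ≤ 1 / 3) (hα2 : 2 * α₀ ≤ c2' d L)
    (h52 : pdev U₀ < α₀ * (((L : ℝ) ^ k)⁻¹) ^ 2)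
    (h176 : SiteBd u' α₄) (h177 : CovBondBd U₀ u' (α₄ * ((L : ℝ) ^ k)⁻¹))
    (hu₁ : InLambda L U₀ u₁ k α₃ (((L : ℝ) ^ k)⁻¹))
    (hα₃ : 0 ≤ α₃) (hα₃' : α₃ ≤ 1 / 50) (hα₄ : 0 ≤ α₄)
    (hs₁ : 10 * C6 d * α₄ ≤ 1) (hs₂ : 3000 * ((d : ℝ) + 1) * L * α₄ ≤ 1) (hs₃ : C4G d L * (α₀ + α₃ + α₄) ≤ 1)
    (hs₄ : 1024 * ((d : ℝ) + 1) * ((d : ℝ) + 4) * L ^ 2 * α₀ ≤ 1) (hs₅ : 32 * ((d : ℝ) + 1) ^ 2 * C6 d * L ^ 2 * α₀ ≤ 1)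
    (hs₆ : 16 * d * C5' d * C6 d * (L : ℝ) ^ 2 * α₀ ≤ 1) :
    ∀ j ≤ k, CovBondBd (avgIter L U₀ j) (utilG L U₀ u' u₁ j) (2 * α₄ * ((L : ℝ) ^ j * ((L : ℝ) ^ k)⁻¹)) ∧
      SiteBd (utilG L U₀ u' u₁ j) (C6 d * α₄) := by
  obtain ⟨hV, hP⟩ := levels_of52 hL hG hU k hα hα3 hα2 h52
  have hη : (0 : ℝ) ≤ ((L : ℝ) ^ k)⁻¹ := by positivity
  have hk : (L : ℝ) ^ k * ((L : ℝ) ^ k)⁻¹ ≤ 1 := by rw [mul_inv_cancel₀ (by positivity)]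
  exact prop10_general' hL (fun j hj => hV j hj.le) (fun j hj => hP j hj.le) h176 h177 hu₁ hη hk hα.le hα₃ hα₃' hα₄
    hs₁ hs₂ hs₃ hs₄ hs₅ hs₆

end Literature.MathematicalPhysics.QuantumFieldTheory.Balaban1983to89.B7Prop10General
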